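import Mathlib

/-!
# P2B `FieldFibreDescendsRegular` — PROVED (lens-3 g8; critic TRIAGE-50 ask (i) "land P2B first")

bears_on: LADDER-RESOLUTION:B · [OURS · CANDIDATE] counted 0; nothing here proves resolution in char p.
Crux: stmt-ResolutionOfSingularities-0549 `Theses.Descent.DescentPerfectToAll`; line valuative-constant-step,
rung 1, sub-stub P2B of `Lines/separated_layer_sketch.lean` (rev 3, namespace `…SeparatedLayer`).

`FieldFibreDescendsRegular` below is the VERBATIM copy of the sketch's P2B (the sketch module is a crux
workfile, not yet a built library module, so it cannot be imported; once it is,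
`example : FieldFibreDescendsRegular ↔ SeparatedLayer.FieldFibreDescendsRegular := Iff.rfl`).

STATUS (rev 2): **PROVED — 0 sorry.**  `theorem fieldFibreDescendsRegular : FieldFibreDescendsRegular`.
(rev 1 was a 2-stub skeleton; both stubs are now theorems.)  Proof = the critic's four-step argument
(TRIAGE-50 §"MOVE 2 / P2B"), formalised as:
* `fibreMaximalIdealExtended` (the content): under the P2B hypotheses the maximal ideal of `A_𝔮`
  (`𝔮 := 𝔫 ∩ A`) is extended from `S`: `𝔪_{A_𝔮} = 𝔪_S · A_𝔮`.  Core = `exists_mul_mem_of_fieldFibre`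
  («Ann commutes with the flat base change `κ_S → κ_R`»): for `a ∈ 𝔮` some `s ∉ 𝔮` has `s·a ∈ 𝔪_S A`.
  Argument: if not, `Ann_{A/𝔪_S A}(ā) ⊆ 𝔮̄`; take `u ∉ 𝔫` with `u·(a⊗1) ∈ 𝔪_R(A⊗R)`; map
  `φ : A ⊗_S R → κ_R ⊗_{κ_S} (A/𝔪_S A)` (kills `𝔪_R(A⊗R)`), so `φ(u)·(1⊗ā) = 0`; by FLATNESS of `κ_R/κ_S`
  (`Module.Flat.lTensor_exact` on `0 → Ann(ā) → F → F`) `φ(u) ∈ κ_R ⊗ Ann(ā)`; the map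
  `ψ : κ_R ⊗_{κ_S} (A/𝔪_S A) → (A ⊗_S R)/𝔫` kills `κ_R ⊗ Ann(ā)` (as `Ann(ā) ⊆ 𝔮̄ ↦ 0`) and
  `ψ ∘ φ = proj`, whence `u ∈ 𝔫`, contradiction.
* `dimPreserved`: for a finite injective extension `S ⊆ A` of domains with `S` local, Noetherian,
  integrally closed and `𝔮 ∩ S = 𝔪_S`: `dim A_𝔮 = dim S`
  [`Ideal.height_eq_height_add_of_liesOver_of_hasGoingDown` + the going-down instance for integral
  extensions of integrally closed domains + `krullDimLE_zero_fibre` (the fibre `A/𝔪_S A` is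
  zero-dimensional: primes over `𝔪_S` are maximal by integrality) +
  `IsLocalization.AtPrime.ringKrullDim_eq_height`].
* composition `FieldFibreDescendsRegular_of` (kernel-checked):
  `spanFinrank 𝔪_{A_𝔮} ≤ spanFinrank 𝔪_S = dim S = dim A_𝔮` and
  `IsRegularLocalRing.of_spanFinrank_maximalIdeal_le`.
Remark: `IsDomain S`, `IsRegularLocalRing S` beyond Noetherian-local, are used only in the composition;
the fibre lemma holds for any local `S → R`, any `S`-algebra `A` (no finiteness, no domain).
-/

open IsLocalRing

namespace Summit.ResolutionOfSingularities.ResolutionOfSingularities.Cruxes.DescentPerfectToAll.FieldFibre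

/-- VERBATIM copy of `SeparatedLayer.FieldFibreDescendsRegular` (sketch rev 3). -/
def FieldFibreDescendsRegular : Prop :=
  ∀ (S R A : Type) [CommRing S] [IsRegularLocalRing S] [IsDomain S] [IsIntegrallyClosed S]
    [CommRing R] [IsLocalRing R] [Algebra S R] [CommRing A] [IsDomain A] [Algebra S A]
    [Module.Finite S A],
    IsLocalHom (algebraMap S R) → Function.Injective (algebraMap S A) →
    ∀ (𝔫 : Ideal (TensorProduct S A R)) [𝔫.IsPrime],
      (IsLocalRing.maximalIdeal R).map
          (Algebra.TensorProduct.includeRight : R →ₐ[S] TensorProduct S A R) ≤ 𝔫 →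
      (∀ b ∈ 𝔫, ∃ u ∉ 𝔫, u * b ∈ (IsLocalRing.maximalIdeal R).map
          (Algebra.TensorProduct.includeRight : R →ₐ[S] TensorProduct S A R)) →
      IsRegularLocalRing (Localization.AtPrime
        (𝔫.comap (Algebra.TensorProduct.includeLeftRingHom : A →+* TensorProduct S A R)))

/-- (Former stub 1, proved below as `fibreMaximalIdealExtended`.) The maximal ideal of `A_𝔮` is extended from `S`. -/
def FibreMaximalIdealExtended : Prop :=
  ∀ (S R A : Type) [CommRing S] [IsRegularLocalRing S] [IsDomain S] [IsIntegrallyClosed S]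
    [CommRing R] [IsLocalRing R] [Algebra S R] [CommRing A] [IsDomain A] [Algebra S A]
    [Module.Finite S A],
    IsLocalHom (algebraMap S R) → Function.Injective (algebraMap S A) →
    ∀ (𝔫 : Ideal (TensorProduct S A R)) [𝔫.IsPrime],
      (IsLocalRing.maximalIdeal R).map
          (Algebra.TensorProduct.includeRight : R →ₐ[S] TensorProduct S A R) ≤ 𝔫 →
      (∀ b ∈ 𝔫, ∃ u ∉ 𝔫, u * b ∈ (IsLocalRing.maximalIdeal R).map
          (Algebra.TensorProduct.includeRight : R →ₐ[S] TensorProduct S A R)) →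
      IsLocalRing.maximalIdeal (Localization.AtPrime
        (𝔫.comap (Algebra.TensorProduct.includeLeftRingHom : A →+* TensorProduct S A R))) =
      (IsLocalRing.maximalIdeal S).map (algebraMap S (Localization.AtPrime
        (𝔫.comap (Algebra.TensorProduct.includeLeftRingHom : A →+* TensorProduct S A R))))

/-- (Former stub 2, proved below as `dimPreserved`.) Dimension is preserved in a finite injective extension of domains over an integrally
closed Noetherian local base, at a prime over the maximal ideal. -/
def DimPreservedOverMaximal : Prop :=
  ∀ (S A : Type) [CommRing S] [IsLocalRing S] [IsNoetherianRing S] [IsDomain S]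
    [IsIntegrallyClosed S] [CommRing A] [IsDomain A] [Algebra S A] [Module.Finite S A],
    Function.Injective (algebraMap S A) →
    ∀ (𝔮 : Ideal A) [𝔮.IsPrime], 𝔮.comap (algebraMap S A) = IsLocalRing.maximalIdeal S →
      ringKrullDim (Localization.AtPrime 𝔮) = ringKrullDim S

/-- The prime `𝔮 = 𝔫 ∩ A` lies over `𝔪_S` (local homomorphism `S → R` and `𝔪_R ⊗ ⊆ 𝔫`). -/
theorem comap_eq_maximalIdeal (S R A : Type) [CommRing S] [IsLocalRing S]
    [CommRing R] [IsLocalRing R] [Algebra S R] [CommRing A] [Algebra S A]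
    (hloc : IsLocalHom (algebraMap S R))
    (𝔫 : Ideal (TensorProduct S A R)) [𝔫.IsPrime]
    (h𝔫 : (IsLocalRing.maximalIdeal R).map
          (Algebra.TensorProduct.includeRight : R →ₐ[S] TensorProduct S A R) ≤ 𝔫) :
    (𝔫.comap (Algebra.TensorProduct.includeLeftRingHom : A →+* TensorProduct S A R)).comap
        (algebraMap S A) = IsLocalRing.maximalIdeal S := by
  haveI := hloc
  apply le_antisymm
  · -- proper ideal of a local ring is contained in the maximal ideal
    apply IsLocalRing.le_maximalIdeal
    intro htop
    apply (inferInstance : 𝔫.IsPrime).ne_top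
    rw [Ideal.eq_top_iff_one] at htop ⊢
    have h1 : (1 : TensorProduct S A R) = (1 : A) ⊗ₜ[S] (1 : R) := rfl
    rw [h1]
    simpa [Ideal.mem_comap] using htop
  · intro s hs
    have hsR : algebraMap S R s ∈ IsLocalRing.maximalIdeal R := by
      simpa [IsLocalRing.mem_maximalIdeal, mem_nonunits_iff] using
        (map_mem_nonunits_iff (algebraMap S R) s).mpr
          (by simpa [IsLocalRing.mem_maximalIdeal, mem_nonunits_iff] using hs)
    have h1 : (Algebra.TensorProduct.includeRight : R →ₐ[S] TensorProduct S A R)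
        (algebraMap S R s) ∈ 𝔫 := h𝔫 (Ideal.mem_map_of_mem _ hsR)
    have h2 : (Algebra.TensorProduct.includeRight : R →ₐ[S] TensorProduct S A R)
        (algebraMap S R s) =
        (Algebra.TensorProduct.includeLeftRingHom : A →+* TensorProduct S A R)
          (algebraMap S A s) := by
      simp [Algebra.TensorProduct.includeLeftRingHom, Algebra.TensorProduct.includeRight_apply,
        Algebra.algebraMap_eq_smul_one]
    rw [Ideal.mem_comap, Ideal.mem_comap, ← h2]
    exact h1

section FibreProof

open TensorProduct Algebra.TensorProduct

variable {S R A : Type} [CommRing S] [IsLocalRing S] [CommRing R] [IsLocalRing R] [Algebra S R]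
  [CommRing A] [Algebra S A]

/-- `𝔪_S` maps into `𝔫` (local homomorphism `S → R` and `𝔪_R ⊗ ⊆ 𝔫`). -/
theorem algebraMap_mem_of_mem_maximalIdeal (hloc : IsLocalHom (algebraMap S R))
    (𝔫 : Ideal (A ⊗[S] R))
    (h𝔫 : (IsLocalRing.maximalIdeal R).map
          (Algebra.TensorProduct.includeRight : R →ₐ[S] A ⊗[S] R) ≤ 𝔫)
    (s : S) (hs : s ∈ IsLocalRing.maximalIdeal S) :
    algebraMap S (A ⊗[S] R) s ∈ 𝔫 := by
  haveI := hloc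
  have hsR : algebraMap S R s ∈ IsLocalRing.maximalIdeal R := by
    simpa [IsLocalRing.mem_maximalIdeal, mem_nonunits_iff] using
      (map_mem_nonunits_iff (algebraMap S R) s).mpr
        (by simpa [IsLocalRing.mem_maximalIdeal, mem_nonunits_iff] using hs)
  have : algebraMap S (A ⊗[S] R) s =
      (Algebra.TensorProduct.includeRight : R →ₐ[S] A ⊗[S] R) (algebraMap S R s) :=
    ((Algebra.TensorProduct.includeRight : R →ₐ[S] A ⊗[S] R).commutes s).symm
  rw [this]
  exact h𝔫 (Ideal.mem_map_of_mem _ hsR)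

/-- MAIN ELEMENTWISE LEMMA («Ann commutes with the flat base change `κ_S → κ_R`»):
for `a ∈ 𝔮 := 𝔫 ∩ A` there is `s ∉ 𝔮` with `s * a ∈ 𝔪_S A`. -/
theorem exists_mul_mem_of_fieldFibre (hloc : IsLocalHom (algebraMap S R))
    (𝔫 : Ideal (A ⊗[S] R)) [𝔫.IsPrime]
    (h𝔫 : (IsLocalRing.maximalIdeal R).map
          (Algebra.TensorProduct.includeRight : R →ₐ[S] A ⊗[S] R) ≤ 𝔫)
    (hfib : ∀ b ∈ 𝔫, ∃ u ∉ 𝔫, u * b ∈ (IsLocalRing.maximalIdeal R).map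
          (Algebra.TensorProduct.includeRight : R →ₐ[S] A ⊗[S] R))
    (a : A) (ha : a ∈ 𝔫.comap (Algebra.TensorProduct.includeLeftRingHom : A →+* A ⊗[S] R)) :
    ∃ s ∉ 𝔫.comap (Algebra.TensorProduct.includeLeftRingHom : A →+* A ⊗[S] R),
      s * a ∈ (IsLocalRing.maximalIdeal S).map (algebraMap S A) := by
  classical
  haveI := hloc
  by_contra hcon
  push Not at hcon
  -- hcon : ∀ s ∉ 𝔮, s * a ∉ I
  obtain ⟨u, hu𝔫, hu⟩ := hfib (a ⊗ₜ[S] (1 : R)) (by simpa [Ideal.mem_comap] using ha)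
  -- the players
  haveI hIne : Nontrivial (A ⊗[S] R ⧸ 𝔫) :=
    Ideal.Quotient.nontrivial_iff.mpr (Ideal.IsPrime.ne_top inferInstance)
  letI algkF : Algebra (IsLocalRing.ResidueField S)
      (A ⧸ (IsLocalRing.maximalIdeal S).map (algebraMap S A)) :=
    inferInstanceAs (Algebra (S ⧸ IsLocalRing.maximalIdeal S)
      (A ⧸ (IsLocalRing.maximalIdeal S).map (algebraMap S A)))
  haveI towkF : IsScalarTower S (IsLocalRing.ResidueField S)
      (A ⧸ (IsLocalRing.maximalIdeal S).map (algebraMap S A)) :=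
    inferInstanceAs (IsScalarTower S (S ⧸ IsLocalRing.maximalIdeal S)
      (A ⧸ (IsLocalRing.maximalIdeal S).map (algebraMap S A)))
  -- k-algebra structure on D := (A ⊗ R)/𝔫
  have hS0 : ∀ s ∈ IsLocalRing.maximalIdeal S,
      (algebraMap S (A ⊗[S] R ⧸ 𝔫)) s = 0 := by
    intro s hs
    rw [IsScalarTower.algebraMap_apply S (A ⊗[S] R) (A ⊗[S] R ⧸ 𝔫), Ideal.Quotient.algebraMap_eq,
      Ideal.Quotient.eq_zero_iff_mem]
    exact algebraMap_mem_of_mem_maximalIdeal hloc 𝔫 h𝔫 s hs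
  let κ : IsLocalRing.ResidueField S →+* (A ⊗[S] R ⧸ 𝔫) :=
    Ideal.Quotient.lift (IsLocalRing.maximalIdeal S) (algebraMap S (A ⊗[S] R ⧸ 𝔫)) hS0
  letI algkD : Algebra (IsLocalRing.ResidueField S) (A ⊗[S] R ⧸ 𝔫) := κ.toAlgebra
  have hκ : ∀ s : S, algebraMap (IsLocalRing.ResidueField S) (A ⊗[S] R ⧸ 𝔫)
      (IsLocalRing.residue S s) = Ideal.Quotient.mk 𝔫 (algebraMap S (A ⊗[S] R) s) := fun s => rfl
  -- φ : A ⊗ R → L ⊗_k F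
  let f : A →ₐ[S] (IsLocalRing.ResidueField R ⊗[IsLocalRing.ResidueField S]
      (A ⧸ (IsLocalRing.maximalIdeal S).map (algebraMap S A))) :=
    { toRingHom := (Algebra.TensorProduct.includeRight :
          (A ⧸ (IsLocalRing.maximalIdeal S).map (algebraMap S A)) →ₐ[IsLocalRing.ResidueField S]
          (IsLocalRing.ResidueField R ⊗[IsLocalRing.ResidueField S]
            (A ⧸ (IsLocalRing.maximalIdeal S).map (algebraMap S A)))).toRingHom.comp
        (Ideal.Quotient.mk ((IsLocalRing.maximalIdeal S).map (algebraMap S A)))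
      commutes' := fun s => by
        show (1 : IsLocalRing.ResidueField R) ⊗ₜ[IsLocalRing.ResidueField S]
            (Ideal.Quotient.mk ((IsLocalRing.maximalIdeal S).map (algebraMap S A))
              (algebraMap S A s)) =
          algebraMap S (IsLocalRing.ResidueField R ⊗[IsLocalRing.ResidueField S]
            (A ⧸ (IsLocalRing.maximalIdeal S).map (algebraMap S A))) s
        rw [Algebra.TensorProduct.algebraMap_apply]
        have e1 : Ideal.Quotient.mk ((IsLocalRing.maximalIdeal S).map (algebraMap S A))
            (algebraMap S A s) =
            (algebraMap S (IsLocalRing.ResidueField S) s) •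
              (1 : A ⧸ (IsLocalRing.maximalIdeal S).map (algebraMap S A)) := by
          rw [← Algebra.algebraMap_eq_smul_one, ← IsScalarTower.algebraMap_apply,
            Ideal.Quotient.mk_algebraMap]
        have e2 : algebraMap S (IsLocalRing.ResidueField R) s =
            (algebraMap S (IsLocalRing.ResidueField S) s) • (1 : IsLocalRing.ResidueField R) := by
          rw [← Algebra.algebraMap_eq_smul_one, ← IsScalarTower.algebraMap_apply]
        rw [e1, e2, TensorProduct.tmul_smul, TensorProduct.smul_tmul'] }
  let g : R →ₐ[S] (IsLocalRing.ResidueField R ⊗[IsLocalRing.ResidueField S]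
      (A ⧸ (IsLocalRing.maximalIdeal S).map (algebraMap S A))) :=
    (Algebra.TensorProduct.includeLeft :
        IsLocalRing.ResidueField R →ₐ[S] (IsLocalRing.ResidueField R ⊗[IsLocalRing.ResidueField S]
          (A ⧸ (IsLocalRing.maximalIdeal S).map (algebraMap S A)))).comp
      (IsScalarTower.toAlgHom S R (IsLocalRing.ResidueField R))
  let φ := Algebra.TensorProduct.lift f g (fun x y => Commute.all _ _)
  have hφ : ∀ (x : A) (r : R), φ (x ⊗ₜ[S] r) =
      (IsLocalRing.residue R r) ⊗ₜ[IsLocalRing.ResidueField S]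
        (Ideal.Quotient.mk ((IsLocalRing.maximalIdeal S).map (algebraMap S A)) x) := by
    intro x r
    simp only [φ, Algebra.TensorProduct.lift_tmul]
    show ((1 : IsLocalRing.ResidueField R) ⊗ₜ[IsLocalRing.ResidueField S]
        (Ideal.Quotient.mk ((IsLocalRing.maximalIdeal S).map (algebraMap S A)) x)) *
        ((IsLocalRing.residue R r) ⊗ₜ[IsLocalRing.ResidueField S] 1) = _
    rw [Algebra.TensorProduct.tmul_mul_tmul, one_mul, mul_one]
  -- φ kills J = 𝔪_R (A ⊗ R)
  have hJ : (IsLocalRing.maximalIdeal R).map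
      (Algebra.TensorProduct.includeRight : R →ₐ[S] A ⊗[S] R) ≤ RingHom.ker φ.toRingHom := by
    rw [Ideal.map_le_iff_le_comap]
    intro m hm
    rw [Ideal.mem_comap, RingHom.mem_ker, AlgHom.toRingHom_eq_coe, RingHom.coe_coe,
      Algebra.TensorProduct.includeRight_apply, hφ, map_one,
      (IsLocalRing.residue_eq_zero_iff m).mpr hm, TensorProduct.zero_tmul]
  have hφu : φ u * ((1 : IsLocalRing.ResidueField R) ⊗ₜ[IsLocalRing.ResidueField S]
      (Ideal.Quotient.mk ((IsLocalRing.maximalIdeal S).map (algebraMap S A)) a)) = 0 := by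
    have := hJ hu
    rw [RingHom.mem_ker, AlgHom.toRingHom_eq_coe, RingHom.coe_coe, map_mul, hφ, map_one] at this
    exact this
  -- flatness of κ_R over κ_S: Ann(ā) ⊗ κ_R = Ann(1 ⊗ ā)
  let μ : (A ⧸ (IsLocalRing.maximalIdeal S).map (algebraMap S A)) →ₗ[IsLocalRing.ResidueField S]
      (A ⧸ (IsLocalRing.maximalIdeal S).map (algebraMap S A)) :=
    LinearMap.mulRight (IsLocalRing.ResidueField S)
      (Ideal.Quotient.mk ((IsLocalRing.maximalIdeal S).map (algebraMap S A)) a)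
  have hex : Function.Exact (LinearMap.ker μ).subtype μ := LinearMap.exact_subtype_ker_map μ
  have hexL := Module.Flat.lTensor_exact (IsLocalRing.ResidueField R) hex
  have hμL : ∀ z : IsLocalRing.ResidueField R ⊗[IsLocalRing.ResidueField S]
      (A ⧸ (IsLocalRing.maximalIdeal S).map (algebraMap S A)),
      (μ.lTensor (IsLocalRing.ResidueField R)) z =
        z * ((1 : IsLocalRing.ResidueField R) ⊗ₜ[IsLocalRing.ResidueField S]
          (Ideal.Quotient.mk ((IsLocalRing.maximalIdeal S).map (algebraMap S A)) a)) := by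
    intro z
    induction z using TensorProduct.induction_on with
    | zero => simp
    | tmul l x =>
        rw [LinearMap.lTensor_tmul, Algebra.TensorProduct.tmul_mul_tmul, mul_one]
        rfl
    | add z₁ z₂ h₁ h₂ => rw [map_add, h₁, h₂, add_mul]
  have hrange : φ u ∈ Set.range ((LinearMap.ker μ).subtype.lTensor (IsLocalRing.ResidueField R)) := by
    rw [← hexL (φ u), hμL]
    exact hφu
  obtain ⟨w, hw⟩ := hrange
  -- ψ : L ⊗_k F → D kills the image of  L ⊗ Ann(ā)  (because Ann(ā) ⊆ 𝔮/I by `hcon`)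
  have hR0 : ∀ r ∈ IsLocalRing.maximalIdeal R,
      ((Ideal.Quotient.mk 𝔫).comp
        (Algebra.TensorProduct.includeRight : R →ₐ[S] A ⊗[S] R).toRingHom) r = 0 := by
    intro r hr
    rw [RingHom.comp_apply, Ideal.Quotient.eq_zero_iff_mem]
    exact h𝔫 (Ideal.mem_map_of_mem _ hr)
  let ψL : IsLocalRing.ResidueField R →ₐ[IsLocalRing.ResidueField S] (A ⊗[S] R ⧸ 𝔫) :=
    { toRingHom := Ideal.Quotient.lift (IsLocalRing.maximalIdeal R)
          ((Ideal.Quotient.mk 𝔫).comp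
            (Algebra.TensorProduct.includeRight : R →ₐ[S] A ⊗[S] R).toRingHom) hR0
      commutes' := fun c => by
        obtain ⟨s, rfl⟩ := IsLocalRing.residue_surjective c
        rw [hκ s, IsLocalRing.ResidueField.algebraMap_residue]
        show Ideal.Quotient.mk 𝔫 ((Algebra.TensorProduct.includeRight : R →ₐ[S] A ⊗[S] R)
          (algebraMap S R s)) = _
        rw [AlgHom.commutes] }
  have hle𝔮 : (IsLocalRing.maximalIdeal S).map (algebraMap S A) ≤
      𝔫.comap (Algebra.TensorProduct.includeLeftRingHom : A →+* A ⊗[S] R) := by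
    rw [Ideal.map_le_iff_le_comap]
    intro s hs
    rw [Ideal.mem_comap, Ideal.mem_comap]
    have : (Algebra.TensorProduct.includeLeftRingHom : A →+* A ⊗[S] R) (algebraMap S A s) =
        algebraMap S (A ⊗[S] R) s := by
      rw [Algebra.TensorProduct.includeLeftRingHom_apply, Algebra.TensorProduct.algebraMap_apply]
    rw [this]
    exact algebraMap_mem_of_mem_maximalIdeal hloc 𝔫 h𝔫 s hs
  have hA0 : ∀ x ∈ (IsLocalRing.maximalIdeal S).map (algebraMap S A),
      ((Ideal.Quotient.mk 𝔫).comp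
        (Algebra.TensorProduct.includeLeftRingHom : A →+* A ⊗[S] R)) x = 0 := by
    intro x hx
    rw [RingHom.comp_apply, Ideal.Quotient.eq_zero_iff_mem]
    exact hle𝔮 hx
  let ψF : (A ⧸ (IsLocalRing.maximalIdeal S).map (algebraMap S A)) →ₐ[IsLocalRing.ResidueField S]
      (A ⊗[S] R ⧸ 𝔫) :=
    { toRingHom := Ideal.Quotient.lift ((IsLocalRing.maximalIdeal S).map (algebraMap S A))
          ((Ideal.Quotient.mk 𝔫).comp
            (Algebra.TensorProduct.includeLeftRingHom : A →+* A ⊗[S] R)) hA0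
      commutes' := fun c => by
        obtain ⟨s, rfl⟩ := IsLocalRing.residue_surjective c
        rw [hκ s]
        have : algebraMap (IsLocalRing.ResidueField S)
            (A ⧸ (IsLocalRing.maximalIdeal S).map (algebraMap S A)) (IsLocalRing.residue S s) =
            Ideal.Quotient.mk _ (algebraMap S A s) := rfl
        rw [this]
        rfl }
  let ψ := Algebra.TensorProduct.lift ψL ψF (fun x y => Commute.all _ _)
  have hψ : ∀ (r : R) (x : A), ψ ((IsLocalRing.residue R r) ⊗ₜ[IsLocalRing.ResidueField S]
      (Ideal.Quotient.mk ((IsLocalRing.maximalIdeal S).map (algebraMap S A)) x)) =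
      Ideal.Quotient.mk 𝔫 (x ⊗ₜ[S] r) := by
    intro r x
    simp only [ψ, Algebra.TensorProduct.lift_tmul]
    show Ideal.Quotient.mk 𝔫 ((1 : A) ⊗ₜ[S] r) * Ideal.Quotient.mk 𝔫 (x ⊗ₜ[S] (1 : R)) = _
    rw [← map_mul, Algebra.TensorProduct.tmul_mul_tmul, one_mul, mul_one]
  -- ψ ∘ φ = projection
  have hψφ : ∀ t : A ⊗[S] R, ψ (φ t) = Ideal.Quotient.mk 𝔫 t := by
    intro t
    induction t using TensorProduct.induction_on with
    | zero => simp
    | tmul x r => rw [hφ, hψ]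
    | add t₁ t₂ h₁ h₂ => rw [map_add, map_add, h₁, h₂, map_add]
  -- ψ kills L ⊗ Ann(ā)
  have hψN : ∀ w' : IsLocalRing.ResidueField R ⊗[IsLocalRing.ResidueField S] (LinearMap.ker μ),
      ψ (((LinearMap.ker μ).subtype.lTensor (IsLocalRing.ResidueField R)) w') = 0 := by
    intro w'
    induction w' using TensorProduct.induction_on with
    | zero => simp
    | tmul l n =>
        rw [LinearMap.lTensor_tmul]
        obtain ⟨r, rfl⟩ := IsLocalRing.residue_surjective l
        obtain ⟨x, hx⟩ := Ideal.Quotient.mk_surjective (n : A ⧸ (IsLocalRing.maximalIdeal S).map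
          (algebraMap S A))
        have hn : (LinearMap.ker μ).subtype n = Ideal.Quotient.mk _ x := by simp [hx]
        rw [hn, hψ, Ideal.Quotient.eq_zero_iff_mem]
        -- x * a ∈ I, hence x ∈ 𝔮 (by hcon), hence x ⊗ r ∈ 𝔫
        have hxa : x * a ∈ (IsLocalRing.maximalIdeal S).map (algebraMap S A) := by
          have h0 := LinearMap.mem_ker.mp n.2
          simp only [μ, LinearMap.mulRight_apply] at h0
          rw [← Ideal.Quotient.eq_zero_iff_mem, map_mul, hx]
          exact h0
        have hx𝔮 : x ∈ 𝔫.comap (Algebra.TensorProduct.includeLeftRingHom : A →+* A ⊗[S] R) := by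
          by_contra hx'
          exact hcon x hx' hxa
        have : x ⊗ₜ[S] r = (Algebra.TensorProduct.includeLeftRingHom x) * ((1 : A) ⊗ₜ[S] r) := by
          rw [Algebra.TensorProduct.includeLeftRingHom_apply, Algebra.TensorProduct.tmul_mul_tmul,
            mul_one, one_mul]
        rw [this]
        exact 𝔫.mul_mem_right _ (Ideal.mem_comap.mp hx𝔮)
    | add w₁ w₂ h₁ h₂ => rw [map_add, map_add, h₁, h₂, add_zero]
  -- conclusion: u ∈ 𝔫
  apply hu𝔫
  rw [← Ideal.Quotient.eq_zero_iff_mem, ← hψφ u, ← hw]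
  exact hψN w

end FibreProof

/-- (Was STUB 1; NOW PROVED, no sorry.) The maximal ideal of `A_𝔮` is extended from `S`. -/
theorem fibreMaximalIdealExtended : FibreMaximalIdealExtended := by
  intro S R A _ _ _ _ _ _ _ _ _ _ _ hloc hinj 𝔫 _ h𝔫 hfib
  set 𝔮 : Ideal A :=
    𝔫.comap (Algebra.TensorProduct.includeLeftRingHom : A →+* TensorProduct S A R) with h𝔮
  haveI : 𝔮.IsPrime := Ideal.IsPrime.comap _
  have hq : 𝔮.comap (algebraMap S A) = IsLocalRing.maximalIdeal S :=
    comap_eq_maximalIdeal S R A hloc 𝔫 h𝔫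
  have hI𝔮 : (IsLocalRing.maximalIdeal S).map (algebraMap S A) ≤ 𝔮 := by
    rw [Ideal.map_le_iff_le_comap, hq]
  rw [← Localization.AtPrime.map_eq_maximalIdeal, IsScalarTower.algebraMap_eq S A
    (Localization.AtPrime 𝔮), ← Ideal.map_map]
  apply le_antisymm
  · rw [Ideal.map_le_iff_le_comap]
    intro a ha
    obtain ⟨s, hs, hsa⟩ := exists_mul_mem_of_fieldFibre hloc 𝔫 h𝔫 hfib a ha
    have hunit : IsUnit (algebraMap A (Localization.AtPrime 𝔮) s) :=
      IsLocalization.map_units (Localization.AtPrime 𝔮) (⟨s, hs⟩ : 𝔮.primeCompl)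
    rw [Ideal.mem_comap, ← Ideal.unit_mul_mem_iff_mem _ hunit, ← map_mul]
    exact Ideal.mem_map_of_mem _ hsa
  · exact Ideal.map_mono hI𝔮

/-- In a finite (integral) extension, a prime over the maximal ideal of a local base: the fibre ring
`A ⧸ 𝔪_S A` is zero-dimensional. -/
theorem krullDimLE_zero_fibre (S A : Type) [CommRing S] [IsLocalRing S] [CommRing A]
    [Algebra S A] [Algebra.IsIntegral S A] :
    Ring.KrullDimLE 0 (A ⧸ (IsLocalRing.maximalIdeal S).map (algebraMap S A)) := by
  refine Ring.KrullDimLE.mk₀ fun P hP => ?_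
  haveI := hP
  haveI hQp : (P.comap (Ideal.Quotient.mk
      ((IsLocalRing.maximalIdeal S).map (algebraMap S A)))).IsPrime := Ideal.IsPrime.comap _
  have hQI : (IsLocalRing.maximalIdeal S).map (algebraMap S A) ≤
      P.comap (Ideal.Quotient.mk ((IsLocalRing.maximalIdeal S).map (algebraMap S A))) := by
    intro x hx
    rw [Ideal.mem_comap, Ideal.Quotient.eq_zero_iff_mem.mpr hx]
    exact P.zero_mem
  have hQS : (P.comap (Ideal.Quotient.mk
      ((IsLocalRing.maximalIdeal S).map (algebraMap S A)))).comap (algebraMap S A) =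
      IsLocalRing.maximalIdeal S := by
    apply le_antisymm
    · apply IsLocalRing.le_maximalIdeal
      intro htop
      apply hQp.ne_top
      rw [Ideal.eq_top_iff_one] at htop ⊢
      simpa [Ideal.mem_comap] using htop
    · rw [← Ideal.map_le_iff_le_comap]
      exact hQI
  have hQmax : (P.comap (Ideal.Quotient.mk
      ((IsLocalRing.maximalIdeal S).map (algebraMap S A)))).IsMaximal := by
    apply Ideal.isMaximal_of_isIntegral_of_isMaximal_comap (R := S)
    rw [hQS]
    exact IsLocalRing.maximalIdeal.isMaximal S
  have hPQ : (P.comap (Ideal.Quotient.mk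
      ((IsLocalRing.maximalIdeal S).map (algebraMap S A)))).map
      (Ideal.Quotient.mk ((IsLocalRing.maximalIdeal S).map (algebraMap S A))) = P :=
    Ideal.map_comap_of_surjective _ Ideal.Quotient.mk_surjective _
  rcases Ideal.map_eq_top_or_isMaximal_of_surjective
      (Ideal.Quotient.mk ((IsLocalRing.maximalIdeal S).map (algebraMap S A)))
      Ideal.Quotient.mk_surjective hQmax with h | h
  · exact absurd (hPQ.symm.trans h) hP.ne_top
  · rwa [hPQ] at h

/-- STUB 2 is PROVED (no sorry): going-down height formula + zero-dimensional fibre. -/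
theorem dimPreserved : DimPreservedOverMaximal := by
  intro S A _ _ _ _ _ _ _ _ _ hinj 𝔮 _ hq
  haveI : FaithfulSMul S A := (faithfulSMul_iff_algebraMap_injective S A).mpr hinj
  haveI : Algebra.IsIntegral S A := inferInstance
  haveI : Algebra.HasGoingDown S A := inferInstance
  haveI : IsNoetherianRing A := IsNoetherianRing.of_finite S A
  haveI : 𝔮.LiesOver (IsLocalRing.maximalIdeal S) := ⟨hq.symm⟩
  rw [IsLocalization.AtPrime.ringKrullDim_eq_height 𝔮 (Localization.AtPrime 𝔮),
    ← IsLocalRing.maximalIdeal_height_eq_ringKrullDim,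
    Ideal.height_eq_height_add_of_liesOver_of_hasGoingDown (IsLocalRing.maximalIdeal S) 𝔮]
  set I := (IsLocalRing.maximalIdeal S).map (algebraMap S A) with hI
  have hI𝔮 : I ≤ 𝔮 := by
    rw [hI, Ideal.map_le_iff_le_comap, hq]
  have hJ : (𝔮.map (Ideal.Quotient.mk I)) ≠ ⊤ := by
    intro htop
    have := congrArg (Ideal.comap (Ideal.Quotient.mk I)) htop
    rw [Ideal.comap_map_of_surjective _ Ideal.Quotient.mk_surjective, Ideal.comap_top] at this
    have hker : Ideal.comap (Ideal.Quotient.mk I) ⊥ = I := by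
      rw [← RingHom.ker_eq_comap_bot, Ideal.mk_ker]
    rw [hker, sup_eq_left.mpr hI𝔮] at this
    exact (inferInstance : 𝔮.IsPrime).ne_top this
  haveI : Nontrivial (A ⧸ I) := Ideal.Quotient.nontrivial_iff.mpr (ne_top_of_le_ne_top
    (inferInstance : 𝔮.IsPrime).ne_top hI𝔮)
  haveI := krullDimLE_zero_fibre S A
  have hdim0 : ringKrullDim (A ⧸ I) = 0 := (ringKrullDimZero_iff_ringKrullDim_eq_zero).mp inferInstance
  have hle := Ideal.height_le_ringKrullDim_of_ne_top hJ
  rw [hdim0] at hle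
  have h0 : (𝔮.map (Ideal.Quotient.mk I)).height = 0 := by
    have : ((𝔮.map (Ideal.Quotient.mk I)).height : WithBot ℕ∞) ≤ ((0 : ℕ∞) : WithBot ℕ∞) := by
      simpa using hle
    exact nonpos_iff_eq_zero.mp (WithBot.coe_le_coe.mp this)
  rw [h0, add_zero]

/-- COMPOSITION (kernel-checked): STUB 1 → STUB 2 → P2B. -/
theorem FieldFibreDescendsRegular_of (h1 : FibreMaximalIdealExtended)
    (h2 : DimPreservedOverMaximal) : FieldFibreDescendsRegular := by
  intro S R A _ _ _ _ _ _ _ _ _ _ _ hloc hinj 𝔫 _ h𝔫 hfib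
  set 𝔮 : Ideal A :=
    𝔫.comap (Algebra.TensorProduct.includeLeftRingHom : A →+* TensorProduct S A R) with h𝔮
  haveI : 𝔮.IsPrime := Ideal.IsPrime.comap _
  haveI : IsNoetherianRing A := IsNoetherianRing.of_finite S A
  haveI : IsNoetherianRing (Localization.AtPrime 𝔮) := inferInstance
  have hq : 𝔮.comap (algebraMap S A) = IsLocalRing.maximalIdeal S :=
    comap_eq_maximalIdeal S R A hloc 𝔫 h𝔫
  have hfibre := h1 S R A hloc hinj 𝔫 h𝔫 hfib
  have hdim : ringKrullDim (Localization.AtPrime 𝔮) = ringKrullDim S := h2 S A hinj 𝔮 hq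
  apply IsRegularLocalRing.of_spanFinrank_maximalIdeal_le
  rw [hdim, ← IsRegularLocalRing.spanFinrank_maximalIdeal (R := S), hfibre]
  exact_mod_cast Ideal.spanFinrank_map_le_of_fg _ (IsNoetherian.noetherian _)

/-- P2B from the fibre statement alone (dimension half discharged by `dimPreserved`). -/
theorem fieldFibreDescendsRegular_of_fibre (h1 : FibreMaximalIdealExtended) :
    FieldFibreDescendsRegular :=
  FieldFibreDescendsRegular_of h1 dimPreserved

/-- **P2B `FieldFibreDescendsRegular` — PROVED** (no sorry, no stub left; statement verbatim the
sketch's).  bears_on: LADDER-RESOLUTION:B · [OURS · CANDIDATE] counted 0; this is one sub-stub (P2B)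
of stub P2 of rung 1 of crux 0549 — nothing here proves resolution in char p. -/
theorem fieldFibreDescendsRegular : FieldFibreDescendsRegular :=
  FieldFibreDescendsRegular_of fibreMaximalIdealExtended dimPreserved

end Summit.ResolutionOfSingularities.ResolutionOfSingularities.Cruxes.DescentPerfectToAll.FieldFibre
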